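import Literature.AlgebraicTopology.Homotopy.CubeFaceMoves
import Mathlib.Algebra.BigOperators.Fin
import HarnessLib

/-!
# The cubical homotopy addition theorem

Topic `Literature/AlgebraicTopology/Homotopy`. For a singular cube `g : Iᴹ⁺³ → X` which is
constant `= x` on the codimension-two skeleton of the cube (`CubeHAT.IsSkelConst`; equivalently,
each of its `2(M + 3)` faces `g ∘ Fin.insertNth j ε`, `ε = 0, 1`, is a map
`(Iᴹ⁺², ∂Iᴹ⁺²) → (X, x)`), the alternating product of the face classes vanishes in the abelian
group `π_{M+2}(X, x)` (Mathlib's `HomotopyGroup (Fin (M + 2)) X x`):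

  **`∏ⱼ ([g ∘ ι_{j,1}] · [g ∘ ι_{j,0}]⁻¹)^((-1)ʲ) = 1`**   (`CubeHAT.altProd_eq_one`).

This is the cubical form of the **homotopy addition theorem** (the boundary of a singular cube
is homotopically trivial; cf. the simplicial statement, Spanier, *Algebraic Topology* (1981),
Ch. 7 §5 Prop. 3, and the cube calculus of Hatcher, *Algebraic Topology* (2002), §4.1,
pp. 340–341, on which the proof here is modelled). Proof: the product `altProd g` is unchanged
when a side face `{y_{i+1} = ε}` is slid into the lid `{y_i = 1}` by the moves of
`CubeFaceMoves.lean` (`altProd_move_unfold`, `altProd_move_unfold'`: the lid picks up the class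
of the side or its inverse through `GenLoop.transAt`/`symmAt`, i.e. `HomotopyGroup.mul_spec`/
`inv_spec`, the side becomes trivial, all other faces keep their classes, and the signs
`(-1)ⁱ`, `(-1)ⁱ⁺¹` are opposite); killing the sides pair by pair from the last coordinate down
(`altProd_eq_one_aux`) reduces to a cube all of whose faces `{y_j = ε}`, `j ≥ 1`, are constant,
for which `g` itself is a homotopy rel `∂Iᴹ⁺²` between its two ends (`faceClass_zero_eq`).
Everything is proved; the statement is used in `Literature/AlgebraicTopology/SingularHomology/`
to derive the simplicial homotopy addition theorem and the Hurewicz theorem.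

## References

* A. Hatcher, *Algebraic Topology*, CUP (2002), §4.1, pp. 340–341. [HatcherAT2002]
* E. H. Spanier, *Algebraic Topology*, Springer (1981), Ch. 7 §5, Prop. 3. [Spanier1981]
-/

noncomputable section

open scoped unitInterval Topology Topology.Homotopy
open Set Function

universe u

namespace Literature.AlgebraicTopology.Homotopy

namespace CubeHAT

open SquareUnfold

variable {M : ℕ} {X : Type u} [TopologicalSpace X] {x : X}

/-! ### The alternating product of the face classes -/

/-- The class `[g ∘ ι_{j,1}] · [g ∘ ι_{j,0}]⁻¹ ∈ π_{M+2}(X, x)` of the pair of opposite faces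
`{y_j = 1}`, `{y_j = 0}` of a cube constant on the codimension-two skeleton. [folklore] -/
def faceRatio (g : C(Fin (M + 3) → I, X)) (hg : IsSkelConst x g) (j : Fin (M + 3)) :
    HomotopyGroup (Fin (M + 2)) X x :=
  faceClass g hg j 1 isExtreme_one * (faceClass g hg j 0 isExtreme_zero)⁻¹

/-- **The alternating product `∏ⱼ ([g ∘ ι_{j,1}] · [g ∘ ι_{j,0}]⁻¹)^((-1)ʲ)`** of the face classes
of a singular cube (the homotopy-theoretic image of the cubical boundary
`∑ⱼ (-1)ʲ (g ∘ ι_{j,1} - g ∘ ι_{j,0})`). [folklore] -/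
def altProd (g : C(Fin (M + 3) → I, X)) (hg : IsSkelConst x g) : HomotopyGroup (Fin (M + 2)) X x :=
  ∏ j : Fin (M + 3), faceRatio g hg j ^ ((-1 : ℤ) ^ (j : ℕ))

/-- A product over `Fin n` is unchanged if two factors change with the same product and the others
not at all. [folklore] -/
lemma prod_eq_of_pair {G : Type*} [CommGroup G] {n : ℕ} {p q : Fin n} (hpq : p ≠ q) {f f' : Fin n → G}
    (hrest : ∀ j, j ≠ p → j ≠ q → f' j = f j) (hpair : f' p * f' q = f p * f q) :
    ∏ j, f' j = ∏ j, f j := by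
  have hq : q ∈ Finset.univ.erase p := Finset.mem_erase.2 ⟨hpq.symm, Finset.mem_univ q⟩
  rw [← Finset.mul_prod_erase _ _ (Finset.mem_univ p), ← Finset.mul_prod_erase _ _ hq,
    ← Finset.mul_prod_erase Finset.univ f (Finset.mem_univ p), ← Finset.mul_prod_erase _ f hq,
    ← mul_assoc, ← mul_assoc, hpair]
  congr 1
  refine Finset.prod_congr rfl fun j hj => ?_
  simp only [Finset.mem_erase] at hj
  exact hrest j hj.2.1 hj.1

/-- The two commutative-group identities behind the invariance of `altProd` under a move.
[folklore] -/
lemma pair_identity {G : Type*} [CommGroup G] (Tp Tq Bp Bq : G) (s : ℤ) :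
    (Tq⁻¹ * Tp * Bp⁻¹) ^ s * (1 * Bq⁻¹) ^ (-s) = (Tp * Bp⁻¹) ^ s * (Tq * Bq⁻¹) ^ (-s) ∧
    (Tp * Bq * Bp⁻¹) ^ s * (Tq * 1⁻¹) ^ (-s) = (Tp * Bp⁻¹) ^ s * (Tq * Bq⁻¹) ^ (-s) := by
  constructor
  · simp only [mul_zpow, inv_zpow', zpow_neg, one_mul, inv_inv, mul_inv]
    ac_rfl
  · simp only [mul_zpow, inv_zpow', zpow_neg, inv_one, mul_one, inv_inv, mul_inv]
    ac_rfl

/-- The sign at `i.succ` is minus the sign at `i.castSucc`. [folklore] -/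
lemma neg_one_pow_succ_eq (i : Fin (M + 2)) :
    ((-1 : ℤ) ^ ((i.succ : Fin (M + 3)) : ℕ)) = -((-1 : ℤ) ^ ((i.castSucc : Fin (M + 3)) : ℕ)) := by
  rw [Fin.val_succ, Fin.val_castSucc, pow_succ, mul_neg_one]

/-! ### Invariance of the alternating product under the moves -/

section Invariance

variable {g : C(Fin (M + 3) → I, X)} (hg : IsSkelConst x g) (i : Fin (M + 2))

/-- Faces away from the moved pair keep their class (both families `unfold`, `unfold'`).
[folklore] -/
lemma faceClass_move_of_ne {Θ : I → I × I → I × I}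
    (hΘc : Continuous fun q : I × (I × I) => Θ q.1 q.2) (h0 : ∀ p, Θ 0 p = p)
    (hΘb : ∀ t, MapsTo (Θ t) sqBoundary sqBoundary) {hc : Continuous (Θ 1)}
    (hg' : IsSkelConst x (move g i (Θ 1) hc))
    {j : Fin (M + 3)} (hjp : j ≠ i.castSucc) (hjq : j ≠ i.succ) {ε : I} (hε : IsExtreme ε) :
    faceClass _ hg' j ε hε = faceClass g hg j ε hε := by
  obtain ⟨a, ha⟩ := Fin.exists_succAbove_eq hjp.symm
  obtain ⟨b, hb⟩ := Fin.exists_succAbove_eq hjq.symm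
  have hab : a ≠ b := by
    rintro rfl
    exact castSucc_ne_succ i (ha.symm.trans hb)
  exact faceClass_precomp_pairMap hg j ha hb hab hΘc h0 hΘb hε hg'

/-- **Invariance under the move by `unfold 1`** (slide the side `{y_q = 1}` into the lid): the
lid class is multiplied by the inverse of the side class, the side becomes trivial, everything
else is unchanged, and the exponents `(-1)ᵖ = -(-1)^q` make the alternating product invariant.
[folklore] -/
theorem altProd_move_unfold (hg' : IsSkelConst x (move g i (unfold 1) (continuous_unfold_right 1))) :
    altProd _ hg' = altProd g hg := by
  unfold altProd
  refine prod_eq_of_pair (castSucc_ne_succ i) (fun j hjp hjq => ?_) ?_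
  · unfold faceRatio
    rw [faceClass_move_of_ne hg i continuous_unfold unfold_zero unfold_mapsTo_sqBoundary hg' hjp hjq,
      faceClass_move_of_ne hg i continuous_unfold unfold_zero unfold_mapsTo_sqBoundary hg' hjp hjq]
  · -- the four changed classes
    have hTp : faceClass _ hg' i.castSucc 1 isExtreme_one =
        (faceClass g hg i.succ 1 isExtreme_one)⁻¹ * faceClass g hg i.castSucc 1 isExtreme_one := by
      rw [faceClass, faceLoop_move_unfold_castSucc_one hg i hg', cls_transAt, cls_symmAt]; rfl
    have hBp : faceClass _ hg' i.castSucc 0 isExtreme_zero = faceClass g hg i.castSucc 0 isExtreme_zero :=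
      faceClass_congr hg hg' _ (move_insertNth_castSucc_zero_of_fixed i _ (unfold_zero_left 1))
    have hTq : faceClass _ hg' i.succ 1 isExtreme_one = 1 :=
      faceClass_eq_one_of_forall (N := M + 2) hg' isExtreme_one
        (move_insertNth_succ_of_collapse i _ hg isExtreme_one unfold_one_one_right)
    have hBq : faceClass _ hg' i.succ 0 isExtreme_zero = faceClass g hg i.succ 0 isExtreme_zero :=
      faceClass_congr hg hg' _ (move_insertNth_succ_of_fixed i _ 0 (unfold_zero_right 1))
    unfold faceRatio
    rw [hTp, hBp, hTq, hBq, neg_one_pow_succ_eq]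
    exact (pair_identity _ _ _ _ _).1

/-- **Invariance under the move by `unfold' 1`** (slide the side `{y_q = 0}` into the lid).
[folklore] -/
theorem altProd_move_unfold' (hg' : IsSkelConst x (move g i (unfold' 1) (continuous_unfold'_right 1))) :
    altProd _ hg' = altProd g hg := by
  unfold altProd
  refine prod_eq_of_pair (castSucc_ne_succ i) (fun j hjp hjq => ?_) ?_
  · unfold faceRatio
    rw [faceClass_move_of_ne hg i continuous_unfold' unfold'_zero unfold'_mapsTo_sqBoundary hg' hjp hjq,
      faceClass_move_of_ne hg i continuous_unfold' unfold'_zero unfold'_mapsTo_sqBoundary hg' hjp hjq]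
  · have hTp : faceClass _ hg' i.castSucc 1 isExtreme_one =
        faceClass g hg i.castSucc 1 isExtreme_one * faceClass g hg i.succ 0 isExtreme_zero := by
      rw [faceClass, faceLoop_move_unfold'_castSucc_one hg i hg', cls_transAt]; rfl
    have hBp : faceClass _ hg' i.castSucc 0 isExtreme_zero = faceClass g hg i.castSucc 0 isExtreme_zero :=
      faceClass_congr hg hg' _ (move_insertNth_castSucc_zero_of_fixed i _ (unfold'_zero_left 1))
    have hTq : faceClass _ hg' i.succ 1 isExtreme_one = faceClass g hg i.succ 1 isExtreme_one :=
      faceClass_congr hg hg' _ (move_insertNth_succ_of_fixed i _ 1 (unfold'_one_right 1))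
    have hBq : faceClass _ hg' i.succ 0 isExtreme_zero = 1 :=
      faceClass_eq_one_of_forall (N := M + 2) hg' isExtreme_zero
        (move_insertNth_succ_of_collapse i _ hg isExtreme_zero unfold'_one_zero_right)
    unfold faceRatio
    rw [hTp, hBp, hTq, hBq, neg_one_pow_succ_eq]
    exact (pair_identity _ _ _ _ _).2

end Invariance

/-! ### The base case: all faces but the two ends constant -/

/-- **If all faces `{y_j = ε}`, `j ≥ 1`, are constant, the two ends have the same class**: `g`,
read with the coordinate `0` as time, is a homotopy rel `∂Iᴹ⁺²` from `g ∘ ι_{0,0}` to `g ∘ ι_{0,1}`.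
[folklore] -/
theorem faceClass_zero_eq {g : C(Fin (M + 3) → I, X)} (hg : IsSkelConst x g)
    (h : ∀ j : Fin (M + 3), j ≠ 0 → ∀ ε, IsExtreme ε → ∀ t, g (Fin.insertNth j ε t) = x) :
    faceClass g hg 0 1 isExtreme_one = faceClass g hg 0 0 isExtreme_zero := by
  have hside : ∀ (s : I) (t : Fin (M + 2) → I), t ∈ Cube.boundary (Fin (M + 2)) →
      g (Fin.insertNth 0 s t) = x := by
    rintro s t ⟨c, hc⟩
    set y : Fin (M + 3) → I := Fin.insertNth 0 s t with hy
    have hyc : y c.succ = t c := by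
      rw [hy, ← Fin.succAbove_zero, Fin.insertNth_apply_succAbove]
    rw [← Fin.insertNth_self_removeNth c.succ y]
    exact h _ (Fin.succ_ne_zero c) _ (by rw [hyc]; exact hc) _
  refine Quotient.sound ⟨{
    toFun := fun q => g (Fin.insertNth 0 (σ q.1) q.2)
    continuous_toFun := g.continuous.comp (by fun_prop)
    map_zero_left := fun t => by simp
    map_one_left := fun t => by simp
    prop' := fun s t ht => by
      change g (Fin.insertNth 0 (σ s) t) = faceLoop g hg 0 1 isExtreme_one t
      rw [faceLoop_apply, hside _ _ ht, hside _ _ ht] }⟩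

/-- The base case: if all faces `{y_j = ε}`, `j ≥ 1`, are constant then `altProd g = 1`. [folklore] -/
theorem altProd_eq_one_of_sides {g : C(Fin (M + 3) → I, X)} (hg : IsSkelConst x g)
    (h : ∀ j : Fin (M + 3), j ≠ 0 → ∀ ε, IsExtreme ε → ∀ t, g (Fin.insertNth j ε t) = x) :
    altProd g hg = 1 := by
  refine Finset.prod_eq_one fun j _ => ?_
  by_cases hj : j = 0
  · subst hj
    rw [faceRatio, faceClass_zero_eq hg h, mul_inv_cancel, one_zpow]
  · rw [faceRatio, faceClass_eq_one_of_forall hg isExtreme_one (h j hj 1 isExtreme_one),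
      faceClass_eq_one_of_forall hg isExtreme_zero (h j hj 0 isExtreme_zero), inv_one, mul_one,
      one_zpow]

/-! ### Killing the sides pair by pair -/

/-- A constant face away from the moved pair stays constant after a move. [folklore] -/
lemma face_move_const {g : C(Fin (M + 3) → I, X)} (i : Fin (M + 2)) {θ : I × I → I × I}
    (hθ : Continuous θ) {j : Fin (M + 3)} (hjp : j ≠ i.castSucc) (hjq : j ≠ i.succ) {ε : I}
    (h : ∀ t, g (Fin.insertNth j ε t) = x) (t : Fin (M + 2) → I) :
    move g i θ hθ (Fin.insertNth j ε t) = x := by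
  obtain ⟨a, ha⟩ := Fin.exists_succAbove_eq hjp.symm
  obtain ⟨b, hb⟩ := Fin.exists_succAbove_eq hjq.symm
  have hab : a ≠ b := by
    rintro rfl
    exact castSucc_ne_succ i (ha.symm.trans hb)
  rw [move_apply, ← ha, ← hb, pairMap_insertNth j hab, h]

/-- Induction on the number of live side pairs: if the faces `{y_j = ε}` with `j > m` are constant,
then `altProd g = 1`. [folklore] -/
theorem altProd_eq_one_aux : ∀ (m : ℕ), m ≤ M + 2 → ∀ (g : C(Fin (M + 3) → I, X))
    (hg : IsSkelConst x g),
    (∀ j : Fin (M + 3), m < (j : ℕ) → ∀ ε, IsExtreme ε → ∀ t, g (Fin.insertNth j ε t) = x) →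
      altProd g hg = 1
  | 0, _, g, hg, h => altProd_eq_one_of_sides hg fun j hj =>
      h j (Nat.pos_of_ne_zero fun h0 => hj (Fin.ext h0))
  | m + 1, hm, g, hg, h => by
    let i : Fin (M + 2) := ⟨m, by omega⟩
    have hiq : ((i.succ : Fin (M + 3)) : ℕ) = m + 1 := rfl
    have hip : ((i.castSucc : Fin (M + 3)) : ℕ) = m := rfl
    -- kill the side `{y_q = 0}`, then `{y_q = 1}`
    have hg₁ : IsSkelConst x (move g i (unfold' 1) (continuous_unfold'_right 1)) :=
      hg.move i _ (unfold'_mapsTo_sqBoundary 1) unfold'_one_mapsTo_sqCorner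
    have hg₂ : IsSkelConst x (move (move g i (unfold' 1) (continuous_unfold'_right 1)) i (unfold 1)
        (continuous_unfold_right 1)) :=
      hg₁.move i _ (unfold_mapsTo_sqBoundary 1) unfold_one_mapsTo_sqCorner
    rw [← altProd_move_unfold' hg i hg₁, ← altProd_move_unfold hg₁ i hg₂]
    refine altProd_eq_one_aux m (by omega) _ hg₂ fun j hj ε hε t => ?_
    by_cases hjq : j = i.succ
    · subst hjq
      rcases hε with rfl | rfl
      · rw [move_insertNth_succ_of_fixed i (continuous_unfold_right 1) 0 (unfold_zero_right 1)]
        exact move_insertNth_succ_of_collapse i (continuous_unfold'_right 1) hg isExtreme_zero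
          unfold'_one_zero_right t
      · exact move_insertNth_succ_of_collapse i (continuous_unfold_right 1) hg₁ isExtreme_one
          unfold_one_one_right t
    · have hjv : m + 1 < (j : ℕ) := by
        rcases Nat.lt_or_ge (m + 1) j with h' | h'
        · exact h'
        · exact absurd (Fin.ext (show (j : ℕ) = (i.succ : Fin (M + 3)) by rw [hiq]; omega)) hjq
      have hjp : j ≠ i.castSucc := fun h' => by rw [h', hip] at hjv; omega
      exact face_move_const i (continuous_unfold_right 1) hjp hjq
        (face_move_const i (continuous_unfold'_right 1) hjp hjq (h j hjv ε hε)) t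

/-- **The cubical homotopy addition theorem**: for a singular cube `g : Iᴹ⁺³ → X` constant `= x`
on the codimension-two skeleton, `∏ⱼ ([g ∘ ι_{j,1}] · [g ∘ ι_{j,0}]⁻¹)^((-1)ʲ) = 1` in
`π_{M+2}(X, x)` (cubical form of Spanier 1981, Ch. 7 §5 Prop. 3; Hatcher 2002, §4.1).
[folklore] -/
theorem altProd_eq_one (g : C(Fin (M + 3) → I, X)) (hg : IsSkelConst x g) : altProd g hg = 1 :=
  altProd_eq_one_aux (M + 2) le_rfl g hg fun j hj => absurd j.isLt (by omega)

/-- The cubical homotopy addition theorem, with the product written out. [folklore] -/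
theorem prod_face_class_zpow_eq_one (g : C(Fin (M + 3) → I, X)) (hg : IsSkelConst x g) :
    ∏ j : Fin (M + 3), (faceClass g hg j 1 isExtreme_one * (faceClass g hg j 0 isExtreme_zero)⁻¹) ^
      ((-1 : ℤ) ^ (j : ℕ)) = 1 :=
  altProd_eq_one g hg

end CubeHAT

end Literature.AlgebraicTopology.Homotopy

end
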